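import Literature.ModelTheory.ProofTheory.SentenceCodes

/-!
# The set of Gödel numbers of existential sentences is decidable

A companion to `SentenceCodes.lean`: for a first-order language with computable arity tables,
the set `{⌜φ⌝ | φ an existential sentence}` — `BoundedFormula.IsExistential`, Mathlib's
syntactic notion: a block of `∃` (`BoundedFormula.ex ψ = ∼(∀' ∼ψ)`) in front of a
quantifier-free matrix (`IsQF`: built from `⊥`, equations, atomic relations and `⟹`) — is a
computable set of naturals (`Literature.ModelTheory.ProofTheory.PreFOL.computablePred_exists_isExistential_godelNumber_eq`).
This is the "recognisability of existential sentences" hypothesis in the bookkeeping direction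
of Macintyre–Wilkie's reduction (`Literature/ModelTheory/ExponentialFields/MacintyreWilkie.lean`,
`Theory.isRecursive_existentialTheory_of_isDecidable`); as arithmetised syntax it is folklore
(Enderton, *A Mathematical Introduction to Logic*, §3.4).

On the letters (`GodelCoding.lean`): a quantifier-free formula is recognised by the recursive
descent `parseQF` (the recogniser `parseF` of `SentenceCodes.lean` without the clause for `∀`),
and `ψ.ex` at depth `k` has letters `3, 7, 3, letters ψ, 4 (k + 1) + 11, 4 k + 11`, which
`exLettersB` peels off recursively.

## Main statements

* `parseQF_formulaLetters`, `exists_isQF_of_parseQF`: the quantifier-free recogniser is complete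
  and sound; `exLettersB_of_isExistential`, `exists_isExistential_of_exLettersB`: so is the
  existential one; `primrec_qF`, `primrec_exF`: both are primitive recursive relative to arity
  tables; `computablePred_exists_isExistential_godelNumber_eq`. [folklore]
-/

namespace Literature.ModelTheory.ProofTheory.PreFOL

open FirstOrder FirstOrder.Language Encodable Denumerable

/-! ### The quantifier-free recogniser -/

/-- Recursive-descent recogniser of the letters of a *quantifier-free* bounded formula at depth
`k` (fuel `f`): `parseF` without the clause for the universal quantifier. [folklore] -/
def parseQF (oF oR : ℕ → Option ℕ) : ℕ → ℕ → List ℕ → Option (List ℕ)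
  | 0, _, _ => none
  | _ + 1, _, [] => none
  | f + 1, k, x :: t =>
    if x = 4 * k + 11 then some t
    else if x = 3 then (parseQF oF oR f k t).bind fun m => parseQF oF oR f k m
    else if x % 2 = 0 then
      match t with
      | [] => none
      | y :: t' => if isTermAtB oF k x = true ∧ isTermAtB oF k y = true then some t' else none
    else if x % 4 = 1 then
      (oR (x / 4)).bind fun a =>
        match t with
        | [] => none
        | y :: t' =>
          if y = 4 * k + 3 ∧ a ≤ t'.length ∧ allTermAtB oF k (t'.take a) = true then
            some (t'.drop a) else none
    else none

section ParseQF

variable {oF oR : ℕ → Option ℕ}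

/-- Without fuel the recogniser fails. [folklore] -/
@[simp] theorem parseQF_zero (k : ℕ) (l : List ℕ) : parseQF oF oR 0 k l = none := rfl

/-- On the empty string the recogniser fails. [folklore] -/
@[simp] theorem parseQF_nil (f k : ℕ) : parseQF oF oR f k [] = none := by cases f <;> rfl

/-- The recursion equation of `parseQF`. [folklore] -/
theorem parseQF_succ_cons (f k x : ℕ) (t : List ℕ) :
    parseQF oF oR (f + 1) k (x :: t) =
      if x = 4 * k + 11 then some t
      else if x = 3 then (parseQF oF oR f k t).bind fun m => parseQF oF oR f k m
      else if x % 2 = 0 then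
        match t with
        | [] => none
        | y :: t' => if isTermAtB oF k x = true ∧ isTermAtB oF k y = true then some t' else none
      else if x % 4 = 1 then
        (oR (x / 4)).bind fun a =>
          match t with
          | [] => none
          | y :: t' =>
            if y = 4 * k + 3 ∧ a ≤ t'.length ∧ allTermAtB oF k (t'.take a) = true then
              some (t'.drop a) else none
      else none :=
  rfl

/-- The remainder returned by the recogniser is a suffix of the input. [folklore] -/
theorem suffix_of_parseQF : ∀ (f k : ℕ) (l r : List ℕ), parseQF oF oR f k l = some r → r <:+ l := by
  intro f
  induction f with
  | zero => intro k l r h; simp at h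
  | succ f ih =>
    intro k l r h
    cases l with
    | nil => simp at h
    | cons x t =>
      rw [parseQF_succ_cons] at h
      split_ifs at h with h1 h2 h4 h5
      · cases h; exact List.suffix_cons _ _
      · obtain ⟨m, hm, hmr⟩ := Option.bind_eq_some_iff.1 h
        exact ((ih k m r hmr).trans (ih k t m hm)).trans (List.suffix_cons _ _)
      · cases t with
        | nil => exact absurd h (by simp)
        | cons y t' =>
          simp only at h
          split_ifs at h
          cases h
          exact ((List.suffix_cons _ _).trans (List.suffix_cons _ _))
      · obtain ⟨a, -, ha⟩ := Option.bind_eq_some_iff.1 h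
        cases t with
        | nil => exact absurd ha (by simp)
        | cons y t' =>
          simp only at ha
          split_ifs at ha
          cases ha
          exact ((List.drop_suffix _ _).trans (List.suffix_cons _ _)).trans (List.suffix_cons _ _)

end ParseQF

section QFLetters

variable {L : Language} [Encodable (Σ i, L.Functions i)] [Encodable (Σ i, L.Relations i)]

/-- **Completeness**: the letters of a quantifier-free formula are read off. [folklore] -/
theorem parseQF_formulaLetters {k : ℕ} {φ : L.BoundedFormula Empty k} (hφ : φ.IsQF) :
    ∀ (rest : List ℕ) (f : ℕ), (formulaLetters φ).length ≤ f →
      parseQF (arityF L) (arityR L) f k (formulaLetters φ ++ rest) = some rest := by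
  induction hφ with
  | falsum =>
    intro rest f hf
    obtain ⟨f, rfl⟩ : ∃ f', f = f' + 1 := ⟨f - 1, by simp at hf; omega⟩
    simp [parseQF_succ_cons]
  | of_isAtomic h =>
    cases h with
    | equal t₁ t₂ =>
      intro rest f hf
      have hlen : (formulaLetters (t₁.bdEqual t₂)).length = 2 := by
        simp [Term.bdEqual, formulaLetters_equal]
      obtain ⟨f, rfl⟩ : ∃ f', f = f' + 1 := ⟨f - 1, by omega⟩
      rw [show t₁.bdEqual t₂ = BoundedFormula.equal t₁ t₂ from rfl, formulaLetters_equal]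
      have h1 : 2 * Nat.pair k (encode t₁) ≠ 4 * k + 11 := by omega
      have h2 : 2 * Nat.pair k (encode t₁) ≠ 3 := by omega
      have h4 : 2 * Nat.pair k (encode t₁) % 2 = 0 := by omega
      have h5 : isTermAtB (arityF L) k (2 * Nat.pair k (encode t₁)) = true :=
        isTermAtB_iff.2 ⟨t₁, rfl⟩
      have h6 : isTermAtB (arityF L) k (2 * Nat.pair k (encode t₂)) = true :=
        isTermAtB_iff.2 ⟨t₂, rfl⟩
      simp [parseQF_succ_cons, h1, h2, h4, h5, h6]
    | rel R ts =>
      rename_i a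
      intro rest f hf
      rw [show R.boundedFormula ts = BoundedFormula.rel R ts from rfl] at hf ⊢
      obtain ⟨f, rfl⟩ : ∃ f', f = f' + 1 := ⟨f - 1, by simp at hf; omega⟩
      rw [formulaLetters_rel]
      have h1 : 4 * encode (⟨a, R⟩ : Σ i, L.Relations i) + 1 ≠ 4 * k + 11 := by omega
      have h2 : 4 * encode (⟨a, R⟩ : Σ i, L.Relations i) + 1 ≠ 3 := by omega
      have h4 : ¬ ((4 * encode (⟨a, R⟩ : Σ i, L.Relations i) + 1) % 2 = 0) := by omega
      have h5 : (4 * encode (⟨a, R⟩ : Σ i, L.Relations i) + 1) % 4 = 1 := by omega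
      have h6 : (4 * encode (⟨a, R⟩ : Σ i, L.Relations i) + 1) / 4 =
          encode (⟨a, R⟩ : Σ i, L.Relations i) := by omega
      have hall : allTermAtB (arityF L) k
          (List.ofFn fun i => 2 * Nat.pair k (encode (ts i))) = true := by
        rw [allTermAtB_eq_true]
        intro z hz
        obtain ⟨i, rfl⟩ := List.mem_ofFn.1 hz
        exact isTermAtB_iff.2 ⟨ts i, rfl⟩
      have htake : ((List.ofFn fun i => 2 * Nat.pair k (encode (ts i))) ++ rest).take a =
          List.ofFn fun i => 2 * Nat.pair k (encode (ts i)) :=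
        take_append_of_length_eq rest (List.length_ofFn)
      have hdrop : ((List.ofFn fun i => 2 * Nat.pair k (encode (ts i))) ++ rest).drop a = rest :=
        drop_append_of_length_eq rest (List.length_ofFn)
      rw [List.cons_append, List.cons_append, parseQF_succ_cons, if_neg h1, if_neg h2,
        if_neg h4, if_pos h5, h6, arityR_encode, Option.bind_some]
      dsimp only
      rw [if_pos ⟨rfl, by simp, by rw [htake]; exact hall⟩, hdrop]
  | imp h₁ h₂ ih₁ ih₂ =>
    intro rest f hf
    obtain ⟨f, rfl⟩ : ∃ f', f = f' + 1 := ⟨f - 1, by simp at hf; omega⟩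
    rw [formulaLetters_imp, List.cons_append, parseQF_succ_cons, if_neg (by omega), if_pos rfl,
      List.append_assoc, ih₁ _ f (by simp at hf; omega), Option.bind_some,
      ih₂ _ f (by simp at hf; omega)]

/-- **Soundness (unique reading)**: a successful run has read the letters of a quantifier-free
formula. [folklore] -/
theorem exists_isQF_of_parseQF :
    ∀ (f k : ℕ) (l r : List ℕ), parseQF (arityF L) (arityR L) f k l = some r →
      ∃ φ : L.BoundedFormula Empty k, φ.IsQF ∧ l = formulaLetters φ ++ r := by
  intro f
  induction f with
  | zero => intro k l r h; simp at h
  | succ f ih =>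
    intro k l r h
    cases l with
    | nil => simp at h
    | cons x t =>
      rw [parseQF_succ_cons] at h
      split_ifs at h with h1 h2 h4 h5
      · cases h
        exact ⟨BoundedFormula.falsum, BoundedFormula.IsQF.falsum, by simp [h1]⟩
      · obtain ⟨m, hm, hmr⟩ := Option.bind_eq_some_iff.1 h
        obtain ⟨φ, hφ, rfl⟩ := ih k t m hm
        obtain ⟨ψ, hψ, rfl⟩ := ih k m r hmr
        exact ⟨φ.imp ψ, hφ.imp hψ, by simp [h2]⟩
      · cases t with
        | nil => exact absurd h (by simp)
        | cons y t' =>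
          simp only at h
          split_ifs at h with hc
          cases h
          obtain ⟨t₁, rfl⟩ := isTermAtB_iff.1 hc.1
          obtain ⟨t₂, rfl⟩ := isTermAtB_iff.1 hc.2
          exact ⟨BoundedFormula.equal t₁ t₂,
            BoundedFormula.IsQF.of_isAtomic (BoundedFormula.IsAtomic.equal t₁ t₂), by simp⟩
      · obtain ⟨a, ha, h⟩ := Option.bind_eq_some_iff.1 h
        obtain ⟨R, hR⟩ := arityR_eq_some_iff.1 ha
        cases t with
        | nil => exact absurd h (by simp)
        | cons y t' =>
          simp only at h
          split_ifs at h with hc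
          cases h
          obtain ⟨hy, hlen, hall⟩ := hc
          rw [allTermAtB_eq_true] at hall
          have hz : ∀ i : Fin a, ∃ s : L.Term (Empty ⊕ Fin k),
              (t'.take a)[i.val]'(by simp; omega) = 2 * Nat.pair k (encode s) := fun i =>
            isTermAtB_iff.1 (hall _ (List.getElem_mem _))
          choose ts hts using hz
          refine ⟨BoundedFormula.rel R ts,
            BoundedFormula.IsQF.of_isAtomic (BoundedFormula.IsAtomic.rel R ts), ?_⟩
          rw [formulaLetters_rel, hR, List.cons_append, List.cons_append]
          have hx : 4 * (x / 4) + 1 = x := by omega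
          rw [hx, hy]
          congr 2
          have hofn : (List.ofFn fun i => 2 * Nat.pair k (encode (ts i))) = t'.take a := by
            apply List.ext_getElem
            · simp; omega
            · intro i hi₁ hi₂
              rw [List.getElem_ofFn]
              exact (hts ⟨i, by simpa using hi₁⟩).symm
          rw [hofn, List.take_append_drop]

end QFLetters

/-! ### The existential recogniser -/

/-- Recogniser of the letters of an *existential* bounded formula at depth `k` (fuel `f`, whole
string): either quantifier-free, or `3, 7, 3, m, 4 (k + 1) + 11, 4 k + 11` with `m` the letters
of an existential formula at depth `k + 1` (the letters of `ψ.ex = ∼(∀' ∼ψ)`). [folklore] -/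
def exLettersB (oF oR : ℕ → Option ℕ) : ℕ → ℕ → List ℕ → Bool
  | 0, _, _ => false
  | f + 1, k, l =>
    decide (parseQF oF oR (l.length + 1) k l = some []) ||
      (decide (l.take 3 = [3, 7, 3]) && decide (5 ≤ l.length) &&
        decide ((l.drop 3).drop (l.length - 5) = [4 * (k + 1) + 11, 4 * k + 11]) &&
        exLettersB oF oR f (k + 1) ((l.drop 3).take (l.length - 5)))

section ExLetters

variable {oF oR : ℕ → Option ℕ}

/-- The recursion equation of `exLettersB`. [folklore] -/
theorem exLettersB_succ (f k : ℕ) (l : List ℕ) :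
    exLettersB oF oR (f + 1) k l =
      (decide (parseQF oF oR (l.length + 1) k l = some []) ||
        (decide (l.take 3 = [3, 7, 3]) && decide (5 ≤ l.length) &&
          decide ((l.drop 3).drop (l.length - 5) = [4 * (k + 1) + 11, 4 * k + 11]) &&
          exLettersB oF oR f (k + 1) ((l.drop 3).take (l.length - 5)))) :=
  rfl

end ExLetters

section ExCorrect

variable {L : Language} [Encodable (Σ i, L.Functions i)] [Encodable (Σ i, L.Relations i)]

/-- The letters of `ψ.ex`. [folklore] -/
theorem formulaLetters_ex {k : ℕ} (ψ : L.BoundedFormula Empty (k + 1)) :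
    formulaLetters ψ.ex = 3 :: 7 :: 3 :: (formulaLetters ψ ++ [4 * (k + 1) + 11, 4 * k + 11]) := by
  rw [show ψ.ex = ((ψ.imp ⊥).all).imp ⊥ from rfl, formulaLetters_imp, formulaLetters_all,
    formulaLetters_imp, show (⊥ : L.BoundedFormula Empty (k + 1)) = BoundedFormula.falsum from rfl,
    show (⊥ : L.BoundedFormula Empty k) = BoundedFormula.falsum from rfl, formulaLetters_falsum,
    formulaLetters_falsum]
  simp

/-- **Completeness**: the letters of an existential formula are accepted (fuel more than the
length). [folklore] -/
theorem exLettersB_of_isExistential {k : ℕ} {φ : L.BoundedFormula Empty k}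
    (hφ : φ.IsExistential) :
    ∀ f : ℕ, (formulaLetters φ).length < f → exLettersB (arityF L) (arityR L) f k (formulaLetters φ) = true := by
  induction hφ with
  | of_isQF h =>
    intro f hf
    obtain ⟨f, rfl⟩ : ∃ f', f = f' + 1 := ⟨f - 1, by omega⟩
    rw [exLettersB_succ, Bool.or_eq_true]
    left
    rw [decide_eq_true_eq]
    simpa using parseQF_formulaLetters h [] _ (Nat.le_succ _)
  | ex h ih =>
    rename_i k ψ
    intro f hf
    obtain ⟨f, rfl⟩ : ∃ f', f = f' + 1 := ⟨f - 1, by omega⟩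
    rw [exLettersB_succ, Bool.or_eq_true]
    right
    rw [formulaLetters_ex] at hf ⊢
    have hlen : (3 :: 7 :: 3 :: (formulaLetters ψ ++ [4 * (k + 1) + 11, 4 * k + 11])).length =
        (formulaLetters ψ).length + 5 := by simp
    have hmid : ((3 :: 7 :: 3 :: (formulaLetters ψ ++ [4 * (k + 1) + 11, 4 * k + 11])).drop 3).take
        ((formulaLetters ψ).length + 5 - 5) = formulaLetters ψ := by
      simp
    have hend : ((3 :: 7 :: 3 :: (formulaLetters ψ ++ [4 * (k + 1) + 11, 4 * k + 11])).drop 3).drop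
        ((formulaLetters ψ).length + 5 - 5) = [4 * (k + 1) + 11, 4 * k + 11] := by
      simp
    rw [hlen, hmid, hend]
    simp only [Bool.and_eq_true, decide_eq_true_eq]
    refine ⟨⟨⟨by simp, by omega⟩, trivial⟩, ih f ?_⟩
    simp at hf
    omega

/-- **Soundness**: an accepted string is the letter string of an existential formula. [folklore] -/
theorem exists_isExistential_of_exLettersB :
    ∀ (f k : ℕ) (l : List ℕ), exLettersB (arityF L) (arityR L) f k l = true →
      ∃ φ : L.BoundedFormula Empty k, φ.IsExistential ∧ formulaLetters φ = l := by
  intro f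
  induction f with
  | zero => intro k l h; simp [exLettersB] at h
  | succ f ih =>
    intro k l h
    rw [exLettersB_succ, Bool.or_eq_true] at h
    rcases h with h | h
    · rw [decide_eq_true_eq] at h
      obtain ⟨φ, hφ, hl⟩ := exists_isQF_of_parseQF _ _ _ _ h
      exact ⟨φ, hφ.isExistential, by rw [hl, List.append_nil]⟩
    · simp only [Bool.and_eq_true, decide_eq_true_eq] at h
      obtain ⟨⟨⟨h3, h5⟩, hend⟩, hrec⟩ := h
      obtain ⟨ψ, hψ, hm⟩ := ih (k + 1) _ hrec
      refine ⟨ψ.ex, hψ.ex, ?_⟩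
      rw [formulaLetters_ex, hm]
      conv_rhs => rw [← List.take_append_drop 3 l, h3,
        ← List.take_append_drop (l.length - 5) (l.drop 3), hend]
      simp

/-- **Correctness on Gödel numbers**: `n` is the Gödel number of an existential sentence iff the
recogniser accepts the list decoded from `n`. [folklore] -/
theorem exists_isExistential_godelNumber_eq_iff (n : ℕ) :
    (∃ φ : L.Sentence, BoundedFormula.IsExistential φ ∧ φ.godelNumber = n) ↔
      exLettersB (arityF L) (arityR L) ((ofNat (List ℕ) n).length + 1) 0 (ofNat (List ℕ) n) = true := by
  constructor
  · rintro ⟨φ, hφ, rfl⟩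
    rw [godelNumber_eq, ofNat_encode]
    exact exLettersB_of_isExistential hφ _ (Nat.lt_succ_self _)
  · intro h
    obtain ⟨φ, hφ, hl⟩ := exists_isExistential_of_exLettersB _ _ _ h
    exact ⟨φ, hφ, by rw [godelNumber_eq, hl, encode_ofNat]⟩

end ExCorrect

/-! ### Primitive recursiveness relative to finite arity tables -/

/-- The table-relative quantifier-free recogniser as a unary function of
`(τF, τR, fuel, depth, letters)`. [folklore] -/
def qF (b : PArg) : Option (List ℕ) := parseQF (tab b.1) (tab b.2.1) b.2.2.1 b.2.2.2.1 b.2.2.2.2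

/-- One step of the quantifier-free recogniser, given the results of the candidate recursive
calls `pCalls` (the same over-approximation as for `parseF`). [folklore] -/
def qStep (τF τR : List (Option ℕ)) (k x : ℕ) (t : List ℕ) (res : List (Option (List ℕ))) :
    Option (List ℕ) :=
  if x = 4 * k + 11 then some t
  else if x = 3 then
    ((res[0]?).getD none).bind fun m => (res[t.length - m.length + 2]?).getD none
  else if x % 2 = 0 then
    match t with
    | [] => none
    | y :: t' =>
      if isTermAtB (tab τF) k x = true ∧ isTermAtB (tab τF) k y = true then some t' else none
  else if x % 4 = 1 then
    (tab τR (x / 4)).bind fun a =>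
      match t with
      | [] => none
      | y :: t' =>
        if y = 4 * k + 3 ∧ a ≤ t'.length ∧ allTermAtB (tab τF) k (t'.take a) = true then
          some (t'.drop a) else none
  else none

/-- The step function of the course-of-values recursion for `qF`. [folklore] -/
def qG (b : PArg) (res : List (Option (List ℕ))) : Option (Option (List ℕ)) :=
  if b.2.2.1 = 0 ∨ b.2.2.2.2 = [] then some none
  else some (qStep b.1 b.2.1 b.2.2.2.1 b.2.2.2.2.headI b.2.2.2.2.tail res)

/-- The remainder returned by `qF`'s recursive call is a suffix (index computation of the second
call of the implication case). [folklore] -/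
theorem qG_pCalls (b : PArg) : qG b ((pCalls b).map qF) = some (qF b) := by
  obtain ⟨τF, τR, f, k, l⟩ := b
  cases f with
  | zero => simp [qG, qF]
  | succ f =>
    cases l with
    | nil => simp [qG, qF]
    | cons x t =>
      simp only [qG, qF, Nat.add_eq_zero_iff, one_ne_zero, and_false, reduceCtorEq, or_self,
        if_false, List.headI_cons, List.tail_cons]
      congr 1
      set res := (pCalls (τF, τR, f + 1, k, x :: t)).map qF with hres
      have hres' : res = qF (τF, τR, f, k, t) :: qF (τF, τR, f, k + 1, t) ::
          (List.range (t.length + 1)).map (fun j => qF (τF, τR, f, k, t.drop j)) := by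
        simp [hres, pCalls, Function.comp_def]
      have h0 : (res[0]?).getD none = parseQF (tab τF) (tab τR) f k t := by simp [hres', qF]
      have h2 : ∀ m, parseQF (tab τF) (tab τR) f k t = some m →
          (res[t.length - m.length + 2]?).getD none = parseQF (tab τF) (tab τR) f k m := by
        intro m hm
        obtain ⟨p, rfl⟩ := suffix_of_parseQF _ _ _ _ hm
        have hj : (p ++ m).length - m.length < (p ++ m).length + 1 := by omega
        rw [hres', List.getElem?_cons_succ, List.getElem?_cons_succ, List.getElem?_map,
          List.getElem?_range hj]
        simp [qF, drop_append_of_length_eq m rfl]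
      rw [parseQF_succ_cons, qStep.eq_def, h0]
      cases hp : parseQF (tab τF) (tab τR) f k t with
      | none => rfl
      | some m => simp only [Option.bind_some, h2 m hp]

section Primrec

open Primrec

/-- `qStep` is primitive recursive in `((τF, τR, k, x, t), res)`. [folklore] -/
theorem primrec_qStep :
    Primrec fun q : PArg × List (Option (List ℕ)) =>
      qStep q.1.1 q.1.2.1 q.1.2.2.1 q.1.2.2.2.1 q.1.2.2.2.2 q.2 := by
  have hτR : Primrec fun q : PArg × List (Option (List ℕ)) => q.1.2.1 := fst.comp (snd.comp fst)
  have hk : Primrec fun q : PArg × List (Option (List ℕ)) => q.1.2.2.1 :=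
    fst.comp (snd.comp (snd.comp fst))
  have hx : Primrec fun q : PArg × List (Option (List ℕ)) => q.1.2.2.2.1 :=
    fst.comp (snd.comp (snd.comp (snd.comp fst)))
  have ht : Primrec fun q : PArg × List (Option (List ℕ)) => q.1.2.2.2.2 :=
    snd.comp (snd.comp (snd.comp (snd.comp fst)))
  have hres : Primrec fun q : PArg × List (Option (List ℕ)) => q.2 := snd
  have hP : Primrec fun q : PArg × List (Option (List ℕ)) =>
      if q.1.2.2.2.1 = 4 * q.1.2.2.1 + 11 then some q.1.2.2.2.2
      else if q.1.2.2.2.1 = 3 then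
        ((q.2[0]?).getD none).bind fun m => (q.2[q.1.2.2.2.2.length - m.length + 2]?).getD none
      else if q.1.2.2.2.1 % 2 = 0 then
        List.casesOn (motive := fun _ => Option (List ℕ)) q.1.2.2.2.2 none fun y t' =>
          eqCase q (y, t')
      else if q.1.2.2.2.1 % 4 = 1 then (tab q.1.2.1 (q.1.2.2.2.1 / 4)).bind (relBind q)
      else none := by
    refine ite (PrimrecRel.comp Primrec.eq hx (nat_add.comp (nat_mul.comp (const 4) hk) (const 11)))
      (option_some.comp ht) ?_
    refine ite (PrimrecRel.comp Primrec.eq hx (const 3)) (primrec_impCase.comp (ht.pair hres)) ?_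
    refine ite (PrimrecRel.comp Primrec.eq (nat_mod.comp hx (const 2)) (const 0))
      (list_casesOn ht (const none) primrec_eqCase) ?_
    exact ite (PrimrecRel.comp Primrec.eq (nat_mod.comp hx (const 4)) (const 1))
      (option_bind (primrec_tab.comp hτR (nat_div.comp hx (const 4))) primrec_relBind) (const none)
  refine hP.of_eq fun q => ?_
  obtain ⟨⟨τF, τR, k, x, t⟩, res⟩ := q
  cases t <;> rfl

/-- `qG` is primitive recursive. [folklore] -/
theorem primrec_qG : Primrec₂ qG := by
  have hf : Primrec fun q : PArg × List (Option (List ℕ)) => q.1.2.2.1 :=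
    fst.comp (snd.comp (snd.comp fst))
  have hl : Primrec fun q : PArg × List (Option (List ℕ)) => q.1.2.2.2.2 :=
    snd.comp (snd.comp (snd.comp (snd.comp fst)))
  have hS : Primrec fun q : PArg × List (Option (List ℕ)) =>
      qStep q.1.1 q.1.2.1 q.1.2.2.2.1 q.1.2.2.2.2.headI q.1.2.2.2.2.tail q.2 :=
    primrec_qStep.comp (((fst.comp fst).pair ((fst.comp (snd.comp fst)).pair
      ((fst.comp (snd.comp (snd.comp (snd.comp fst)))).pair ((list_headI.comp hl).pair
        (list_tail.comp hl))))).pair snd)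
  exact (ite (PrimrecPred.or (PrimrecRel.comp Primrec.eq hf (const 0))
    (PrimrecRel.comp Primrec.eq hl (const []))) (const (some none)) (option_some.comp hS)).to₂

/-- **The table-relative quantifier-free recogniser is primitive recursive.** [folklore] -/
theorem primrec_qF : Primrec qF :=
  nat_omega_rec' qF (fst.comp (snd.comp snd)) primrec_pCalls primrec_qG pCalls_lt qG_pCalls

/-- The table-relative existential recogniser as a unary function of
`(τF, τR, fuel, depth, letters)`. [folklore] -/
def exF (b : PArg) : Bool := exLettersB (tab b.1) (tab b.2.1) b.2.2.1 b.2.2.2.1 b.2.2.2.2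

/-- The (single) recursive call of `exF`. [folklore] -/
def exCalls (b : PArg) : List PArg :=
  if b.2.2.1 = 0 then [] else
    [(b.1, b.2.1, b.2.2.1 - 1, b.2.2.2.1 + 1, (b.2.2.2.2.drop 3).take (b.2.2.2.2.length - 5))]

/-- The step function of the recursion for `exF`. [folklore] -/
def exG (b : PArg) (res : List Bool) : Option Bool :=
  if b.2.2.1 = 0 then some false else
    some (decide (qF (b.1, b.2.1, b.2.2.2.2.length + 1, b.2.2.2.1, b.2.2.2.2) = some []) ||
      (decide (b.2.2.2.2.take 3 = [3, 7, 3]) && decide (5 ≤ b.2.2.2.2.length) &&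
        decide ((b.2.2.2.2.drop 3).drop (b.2.2.2.2.length - 5) =
          [4 * (b.2.2.2.1 + 1) + 11, 4 * b.2.2.2.1 + 11]) &&
        (res[0]?).getD false))

/-- The recursive call has less fuel. [folklore] -/
theorem exCalls_lt (b : PArg) : ∀ b' ∈ exCalls b, b'.2.2.1 < b.2.2.1 := by
  intro b' hb'
  unfold exCalls at hb'
  split_ifs at hb' with h
  · simp at hb'
  · simp only [List.mem_singleton] at hb'
    subst hb'
    simp
    omega

/-- The step function computes `exF` from the result of the recursive call. [folklore] -/
theorem exG_exCalls (b : PArg) : exG b ((exCalls b).map exF) = some (exF b) := by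
  obtain ⟨τF, τR, f, k, l⟩ := b
  cases f with
  | zero => simp [exG, exF, exLettersB]
  | succ f =>
    simp only [exG, exF, exCalls, Nat.add_eq_zero_iff, one_ne_zero, and_false, if_false,
      List.map_cons, List.map_nil, List.getElem?_cons_zero, Option.getD_some, Nat.add_sub_cancel,
      exLettersB_succ]
    rfl

/-- `exCalls` is primitive recursive. [folklore] -/
theorem primrec_exCalls : Primrec exCalls := by
  have hτF : Primrec fun b : PArg => b.1 := fst
  have hτR : Primrec fun b : PArg => b.2.1 := fst.comp snd
  have hf : Primrec fun b : PArg => b.2.2.1 - 1 := nat_sub.comp (fst.comp (snd.comp snd)) (const 1)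
  have hk : Primrec fun b : PArg => b.2.2.2.1 + 1 := succ.comp (fst.comp (snd.comp (snd.comp snd)))
  have hl : Primrec fun b : PArg => b.2.2.2.2 := snd.comp (snd.comp (snd.comp snd))
  have hm : Primrec fun b : PArg => (b.2.2.2.2.drop 3).take (b.2.2.2.2.length - 5) :=
    list_take.comp (nat_sub.comp (list_length.comp hl) (const 5)) (list_drop.comp (const 3) hl)
  refine ite (PrimrecRel.comp Primrec.eq (fst.comp (snd.comp snd)) (const 0)) (const []) ?_
  exact list_cons.comp (hτF.pair (hτR.pair (hf.pair (hk.pair hm)))) (const [])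

/-- `exG` is primitive recursive. [folklore] -/
theorem primrec_exG : Primrec₂ exG := by
  have hτF : Primrec fun q : PArg × List Bool => q.1.1 := fst.comp fst
  have hτR : Primrec fun q : PArg × List Bool => q.1.2.1 := fst.comp (snd.comp fst)
  have hf : Primrec fun q : PArg × List Bool => q.1.2.2.1 := fst.comp (snd.comp (snd.comp fst))
  have hk : Primrec fun q : PArg × List Bool => q.1.2.2.2.1 :=
    fst.comp (snd.comp (snd.comp (snd.comp fst)))
  have hl : Primrec fun q : PArg × List Bool => q.1.2.2.2.2 :=
    snd.comp (snd.comp (snd.comp (snd.comp fst)))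
  have hq' := primrec_qF.comp (hτF.pair (hτR.pair ((succ.comp (list_length.comp hl)).pair
    (hk.pair hl))))
  have hq : PrimrecPred fun q : PArg × List Bool =>
      qF (q.1.1, q.1.2.1, q.1.2.2.2.2.length + 1, q.1.2.2.2.1, q.1.2.2.2.2) = some [] :=
    PrimrecRel.comp Primrec.eq hq' (const (some []))
  have h3 : PrimrecPred fun q : PArg × List Bool => q.1.2.2.2.2.take 3 = [3, 7, 3] :=
    PrimrecRel.comp Primrec.eq (list_take.comp (const 3) hl) (const [3, 7, 3])
  have h5 : PrimrecPred fun q : PArg × List Bool => 5 ≤ q.1.2.2.2.2.length :=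
    PrimrecRel.comp nat_le (const 5) (list_length.comp hl)
  have hend' : Primrec fun q : PArg × List Bool =>
      (q.1.2.2.2.2.drop 3).drop (q.1.2.2.2.2.length - 5) :=
    list_drop.comp (nat_sub.comp (list_length.comp hl) (const 5)) (list_drop.comp (const 3) hl)
  have hpat : Primrec fun q : PArg × List Bool => [4 * (q.1.2.2.2.1 + 1) + 11, 4 * q.1.2.2.2.1 + 11] :=
    list_cons.comp (nat_add.comp (nat_mul.comp (const 4) (succ.comp hk)) (const 11))
      (list_cons.comp (nat_add.comp (nat_mul.comp (const 4) hk) (const 11)) (const []))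
  have hend : PrimrecPred fun q : PArg × List Bool =>
      (q.1.2.2.2.2.drop 3).drop (q.1.2.2.2.2.length - 5) =
        [4 * (q.1.2.2.2.1 + 1) + 11, 4 * q.1.2.2.2.1 + 11] :=
    PrimrecRel.comp Primrec.eq hend' hpat
  have hres : Primrec fun q : PArg × List Bool => (q.2[0]?).getD false :=
    option_getD.comp (list_getElem?.comp snd (const 0)) (const false)
  have hbody : Primrec fun q : PArg × List Bool =>
      decide (qF (q.1.1, q.1.2.1, q.1.2.2.2.2.length + 1, q.1.2.2.2.1, q.1.2.2.2.2) = some []) ||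
        (decide (q.1.2.2.2.2.take 3 = [3, 7, 3]) && decide (5 ≤ q.1.2.2.2.2.length) &&
          decide ((q.1.2.2.2.2.drop 3).drop (q.1.2.2.2.2.length - 5) =
            [4 * (q.1.2.2.2.1 + 1) + 11, 4 * q.1.2.2.2.1 + 11]) &&
          (q.2[0]?).getD false) :=
    Primrec.or.comp hq.decide (Primrec.and.comp (Primrec.and.comp (Primrec.and.comp h3.decide
      h5.decide) hend.decide) hres)
  exact (ite (PrimrecRel.comp Primrec.eq hf (const 0)) (const (some false))
    (option_some.comp hbody)).to₂

/-- **The table-relative existential recogniser is primitive recursive.** [folklore] -/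
theorem primrec_exF : Primrec exF :=
  nat_omega_rec' exF (fst.comp (snd.comp snd)) primrec_exCalls primrec_exG exCalls_lt exG_exCalls

end Primrec

/-! ### Changing the oracles below a bound; the decision procedure -/

section Congr

variable {oF oF' oR oR' : ℕ → Option ℕ} {B : ℕ}

/-- The quantifier-free recogniser only consults the oracles below the letters. [folklore] -/
theorem parseQF_congr (hoF : ∀ i < B, oF i = oF' i) (hoR : ∀ i < B, oR i = oR' i) :
    ∀ (f k : ℕ) (l : List ℕ), (∀ x ∈ l, x < B) → parseQF oF oR f k l = parseQF oF' oR' f k l := by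
  intro f
  induction f with
  | zero => intros; rfl
  | succ f ih =>
    intro k l hl
    cases l with
    | nil => simp
    | cons x t =>
      have hx : x < B := hl x List.mem_cons_self
      have ht : ∀ z ∈ t, z < B := fun z hz => hl z (List.mem_cons_of_mem _ hz)
      have hbind : ((parseQF oF' oR' f k t).bind fun m => parseQF oF oR f k m) =
          (parseQF oF' oR' f k t).bind fun m => parseQF oF' oR' f k m := by
        cases hp : parseQF oF' oR' f k t with
        | none => rfl
        | some m =>
          simp only [Option.bind_some]
          exact ih k m fun z hz => ht z ((suffix_of_parseQF _ _ _ _ hp).subset hz)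
      rw [parseQF_succ_cons, parseQF_succ_cons, ih k t ht, hbind, hoR (x / 4) (by omega),
        isTermAtB_congr hoF hx]
      cases t with
      | nil => rfl
      | cons y t' =>
        have hy : y < B := ht y List.mem_cons_self
        have ht' : ∀ z ∈ t', z < B := fun z hz => ht z (List.mem_cons_of_mem _ hz)
        have hall : ∀ a, allTermAtB oF k (t'.take a) = allTermAtB oF' k (t'.take a) := fun a =>
          allTermAtB_congr hoF fun z hz => ht' z (List.take_subset _ _ hz)
        simp only [isTermAtB_congr hoF hy, hall]

/-- The existential recogniser only consults the oracles below the letters. [folklore] -/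
theorem exLettersB_congr (hoF : ∀ i < B, oF i = oF' i) (hoR : ∀ i < B, oR i = oR' i) :
    ∀ (f k : ℕ) (l : List ℕ), (∀ x ∈ l, x < B) →
      exLettersB oF oR f k l = exLettersB oF' oR' f k l := by
  intro f
  induction f with
  | zero => intros; rfl
  | succ f ih =>
    intro k l hl
    rw [exLettersB_succ, exLettersB_succ, parseQF_congr hoF hoR _ _ _ hl,
      ih (k + 1) _ fun z hz => hl z (List.drop_subset _ _ (List.take_subset _ _ hz))]

end Congr

section Decide

variable {L : Language} [Encodable (Σ i, L.Functions i)] [Encodable (Σ i, L.Relations i)]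

/-- **The existential recogniser with computable oracles is computable.** [folklore] -/
theorem computable_exLettersB {arF arR : ℕ → Option ℕ} (hF : Computable arF)
    (hR : Computable arR) :
    Computable fun n : ℕ =>
      exLettersB arF arR ((ofNat (List ℕ) n).length + 1) 0 (ofNat (List ℕ) n) := by
  -- (compositions are bound before use: elaborating them against an expected type is a costly
  -- higher-order unification)
  have h0 := primrec_exF.comp (Primrec.fst.pair ((Primrec.fst.comp Primrec.snd).pair
      ((Primrec.succ.comp (Primrec.list_length.comp (Primrec.snd.comp Primrec.snd))).pair
        ((Primrec.const 0).pair (Primrec.snd.comp Primrec.snd)))))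
    (α := List (Option ℕ) × List (Option ℕ) × List ℕ)
  have h1 := h0.to_comp.comp (((computable_arityTable hF).comp Computable.succ).pair
      (((computable_arityTable hR).comp Computable.succ).pair (Computable.ofNat (List ℕ))))
  refine h1.of_eq fun n => ?_
  show exLettersB (tab (arityTable arF (n + 1))) (tab (arityTable arR (n + 1)))
    ((ofNat (List ℕ) n).length + 1) 0 (ofNat (List ℕ) n) = _
  exact exLettersB_congr (B := n + 1) (fun i hi => tab_arityTable_of_lt hi)
    (fun i hi => tab_arityTable_of_lt hi) _ _ _ (fun x hx => Nat.lt_succ_of_lt (lt_of_mem_ofNat hx))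

/-- **The set of Gödel numbers of existential sentences is decidable**, for a language with
computable arity tables (in particular a recursively presented one; Enderton 2001, §3.4). [cite: Enderton2001, §3.4] -/
theorem computablePred_exists_isExistential_godelNumber_eq (hF : Computable (arityF L))
    (hR : Computable (arityR L)) :
    ComputablePred fun n : ℕ =>
      ∃ φ : L.Sentence, BoundedFormula.IsExistential φ ∧ φ.godelNumber = n :=
  ComputablePred.computable_iff.2 ⟨_, computable_exLettersB hF hR,
    funext fun n => propext (exists_isExistential_godelNumber_eq_iff n)⟩

end Decide

end Literature.ModelTheory.ProofTheory.PreFOL
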